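import Summits.CriticalPhenomena.PercolationContinuityZ3.Theses.PercNearOneGluing
import Literature.Probability.Percolation.PercolationEvents
import HarnessLib.Audit

/-! TTRL-lite variant V2367 of stmt-CriticalPhenomena-4574 -/

namespace Summit.CriticalPhenomena.PercolationContinuityZ3.Theorems

open MeasureTheory Set Literature.Probability.LatticeModels Literature.Probability.Percolation
open scoped Classical BigOperators

/-- TTRL-lite variant V2367 (small case `n ≤ 2`) of the shortening step of
`stmt-CriticalPhenomena-4574`: with `v ≠ x` in `Fin n`, `n ≤ 2`, the relay point `a₀ ∈ A ∌ v`
equals `x`; after updating the weight of `s(v, x)` to `1` that edge is almost surely open, so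
`P(a₀ ↔ b) ≤ P(v ↔ b)`, and `P(⋃ a ∈ A, v ↔ a) ≤ 1` finishes. -/
theorem stub_shorteningStep_var2367 :
    ∀ (n : ℕ) (w : Sym2 (Fin n) → unitInterval) (A : Finset (Fin n)) (b v x a₀ : Fin n), n ≤ 2 → v ∉ A → v ≠ x → w s(v, x) = 0 → a₀ ∈ A → (∀ a ∈ A, (prodBernoulli w).real (openConn a₀ b) ≤ (prodBernoulli w).real (openConn a b)) → (∀ w' : Sym2 (Fin n) → unitInterval, (∀ e, w e = 0 → w' e = 0) → ∀ (A' : Finset (Fin n)) (o' b' : Fin n) (t : ℝ), (∀ a ∈ A', t ≤ (prodBernoulli w').real (openConn a b')) → (prodBernoulli w').real (⋃ a ∈ A', openConn o' a) * t ≤ (prodBernoulli w').real (openConn o' b')) → (prodBernoulli (Function.update w s(v, x) 1)).real (⋃ a ∈ A, openConn v a) * (prodBernoulli (Function.update w s(v, x) 1)).real (openConn a₀ b) ≤ (prodBernoulli (Function.update w s(v, x) 1)).real (openConn v b) := by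
  intro n w A b v x a₀ hn hvA hvx _ ha₀ _ _
  -- two vertices only: `a₀ ≠ v` (as `v ∉ A ∋ a₀`) and `x ≠ v` force `a₀ = x`
  have hav : a₀ ≠ v := fun h => hvA (h ▸ ha₀)
  have hax : a₀ = x := by
    have h1 := v.isLt
    have h2 := x.isLt
    have h3 := a₀.isLt
    have hvx' : (v : ℕ) ≠ (x : ℕ) := fun h => hvx (Fin.ext h)
    have hav' : (a₀ : ℕ) ≠ (v : ℕ) := fun h => hav (Fin.ext h)
    apply Fin.ext
    omega
  set w1 : Sym2 (Fin n) → unitInterval := Function.update w s(v, x) 1 with hw1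
  have hw1e : w1 s(v, x) = 1 := by simp [hw1]
  -- the weight-one edge is almost surely open (one-coordinate marginal of the product measure)
  have hnull : (prodBernoulli w1) {ω | s(v, x) ∉ ω} = 0 := by
    calc (prodBernoulli w1) {ω | s(v, x) ∉ ω}
        = (Measure.infinitePi fun i : Sym2 (Fin n) =>
            unitInterval.toNNReal (w1 i) • Measure.dirac True +
              unitInterval.toNNReal (unitInterval.symm (w1 i)) • Measure.dirac False)
            ((fun q : Sym2 (Fin n) → Prop => {i | q i}) ⁻¹' {ω | s(v, x) ∉ ω}) := by
          rw [prodBernoulli_eq_map]; exact MeasurableEquiv.setOf.map_apply _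
      _ = (Measure.infinitePi fun i : Sym2 (Fin n) =>
            unitInterval.toNNReal (w1 i) • Measure.dirac True +
              unitInterval.toNNReal (unitInterval.symm (w1 i)) • Measure.dirac False)
            (cylinder {s(v, x)} {fun _ => False}) := by
          congr 1; ext q; simp [funext_iff]
      _ = 0 := by simp [Measure.infinitePi_cylinder, hw1e]
  -- `a₀ ↔ b` implies `v ↔ b` off the null set where the weight-one edge `s(v, x)` is closed
  have hsub : (openConn a₀ b : Set (BondConfig (Fin n))) ≤ᵐ[prodBernoulli w1]
      (openConn v b : Set (BondConfig (Fin n))) := by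
    refine ae_le_set.2 (measure_mono_null ?_ hnull)
    intro ω hω he
    have hadj : (openGraph ω).Adj v x := (openGraph_adj ω v x).2 ⟨he, hvx⟩
    have hxb : (openGraph ω).Reachable x b := by rw [← hax]; exact hω.1
    exact hω.2 (hadj.reachable.trans hxb)
  have hle : (prodBernoulli w1).real (openConn a₀ b) ≤ (prodBernoulli w1).real (openConn v b) := by
    simp only [measureReal_def]
    exact ENNReal.toReal_mono (measure_ne_top _ _) (measure_mono_ae hsub)
  have h1 : (prodBernoulli w1).real (⋃ a ∈ A, openConn v a) ≤ 1 := measureReal_le_one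
  have h0 : 0 ≤ (prodBernoulli w1).real (openConn a₀ b) := measureReal_nonneg
  calc (prodBernoulli w1).real (⋃ a ∈ A, openConn v a) * (prodBernoulli w1).real (openConn a₀ b)
      ≤ 1 * (prodBernoulli w1).real (openConn a₀ b) := mul_le_mul_of_nonneg_right h1 h0
    _ = (prodBernoulli w1).real (openConn a₀ b) := one_mul _
    _ ≤ (prodBernoulli w1).real (openConn v b) := hle

end Summit.CriticalPhenomena.PercolationContinuityZ3.Theorems
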